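import Summits.RiemannHypothesis.RiemannHypothesis.Theorems.JensenPolynomialsSkeletonLaguerre
import Literature.NumberTheory.LFunctions.WangYang2024.TuranInequalitiesProofs
import Literature.NumberTheory.LFunctions.JensenHyperbolicityRangesRS
import Literature.NumberTheory.LFunctions.XiMoments

/-!
# Route `JensenPolynomials` — rung J-P (P1⁺) for `γ = xiTaylorCoeff`: ISOLATION of the one sign inequality, glue G1,
# and the label theorems `TheoremAlphaCert → TheoremAlpha → JensenCubicRangeTwo`

**RH-FREE.** For the Taylor data `γ = xiTaylorCoeff` of `ξ`:

* `skelKappaSq_xi_pos` — `κ_n² = (n + 3/2)(1 − γ(n+2)γ(n)/γ(n+1)²) > 0` for EVERY `n`, from the strict Turán inequalities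
  (Csordas–Norfolk–Varga 1986, tree theorem `WangYang2024.xiTaylorCoeff_mul_lt_sq`) — so the Laguerre–Bessel skeleton of
  every cell `(d, n)` is hyperbolic with simple zeros (S2);
* **ISOLATION** (`skeletonSignTest_xi_iff`): for every `d ≥ 2` and every `n`, ALL fields of the certificate
  `SkeletonSignTest xiTaylorCoeff d n` except `sameSign` are tree theorems; the test is EQUIVALENT to the single inequality
  family `P(e)·P⁰(e) > 0` at the `d − 1` critical points `e` of the skeleton `P⁰` — exactly the quantity the column's DATA
  engine certified cell by cell (DATA §9 D1: failure set `[0, n_S(d))`, `d ≤ 100`; ET7: margin `μ(d,n) = min_i P(e_i)/P⁰(e_i)`,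
  `3 ≤ d ≤ 20`, four legs). Formalising this fixes WHICH inequality a kernel proof of the P1⁺ rung must establish; it does
  not prove it;
* **G1** (`SkeletonSignTest.splits_jensenPoly`, `skeletonSignTest_implies_splits`): the certificate implies hyperbolicity
  of `J^{d,n}_γ` (S1 + S3);
* **labels** (`theoremAlpha_of_theoremAlphaCert`, `jensenCubicRangeTwo_of_theoremAlpha`): the CAL-certified certificate law
  `TheoremAlphaCert` implies the range law `TheoremAlpha` (both `@[conjecture]`, NOT tree theorems), which implies the route's
  leaf statement `JensenCubicRangeTwo` (using the tree's height-bought `d ≤ 10⁶` theorem below the `10⁴` floor). These are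
  bookkeeping implications between typed targets — an alternative, Laguerre-skeleton assembly for the leaf whose ONE
  residual is the RH-FREE inequality family isolated above; nothing is discharged about `ξ` beyond `κ² > 0`.

WHAT THIS IS NOT: not a proof of `TheoremAlphaCert`, `TheoremAlpha` or `JensenCubicRangeTwo`; not evidence about zeros of `ζ`;
nothing here bears on the truth of RH.
-/

noncomputable section
-- D-0017: `Summit.RiemannHypothesis.RiemannHypothesis.…` duplicates the namespace BY DESIGN (single-problem summit).
set_option linter.dupNamespace false

namespace Summit.RiemannHypothesis.RiemannHypothesis.Theorems.JensenPolynomials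

open Literature.NumberTheory.LFunctions Polynomial Finset
open scoped BigOperators Nat

/-! ## G1 for an arbitrary positive sequence -/

/-- **G1 (RH-FREE, ξ-free form)**: for a positive sequence `γ`, the skeleton sign test at `(d, n)` implies that `J^{d,n}_γ`
is hyperbolic (S1 `SkeletonCertificate.splits_nodup` + S3 `splits_jensenPoly_of_appellPoly_windowSeq`). -/
theorem SkeletonSignTest.splits_jensenPoly {γ : ℕ → ℝ} (hpos : ∀ k, 0 < γ k) {d n : ℕ}
    (h : SkeletonSignTest γ d n) : (jensenPoly γ d n).Splits := by
  obtain ⟨hPs, hPnd⟩ := SkeletonCertificate.splits_nodup h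
  exact splits_jensenPoly_of_appellPoly_windowSeq hpos hPs hPnd

/-! ## The skeleton of `ξ` is non-degenerate at every shift -/

/-- **`κ_n² > 0` for `γ = xiTaylorCoeff`, every `n`** — the strict Turán inequality `γ(n)γ(n+2) < γ(n+1)²`
(Csordas–Norfolk–Varga 1986; tree `WangYang2024.xiTaylorCoeff_mul_lt_sq`) in the skeleton's units. RH-FREE. -/
theorem skelKappaSq_xi_pos (n : ℕ) : 0 < skelKappaSq xiTaylorCoeff n := by
  have hpos : ∀ k, 0 < xiTaylorCoeff k := xiTaylorCoeff_pos_holds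
  rw [skelKappaSq, windowSeq_two _ _ (hpos n).ne']
  have hT := Literature.NumberTheory.LFunctions.WangYang2024.xiTaylorCoeff_mul_lt_sq n
  have h1 : xiTaylorCoeff (n + 2) * xiTaylorCoeff n / xiTaylorCoeff (n + 1) ^ 2 < 1 := by
    rw [div_lt_one (pow_pos (hpos (n + 1)) 2)]
    linarith
  exact mul_pos (by positivity) (by linarith)

/-- `κ_n > 0` for `γ = xiTaylorCoeff`. RH-FREE. -/
theorem skelKappa_xi_pos (n : ℕ) : 0 < skelKappa xiTaylorCoeff n :=
  Real.sqrt_pos.mpr (skelKappaSq_xi_pos n)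

/-- S2 for `ξ`: the centred Laguerre–Bessel skeleton of EVERY cell `(d, n)` splits over `ℝ` with simple zeros and has
degree `d`. RH-FREE. -/
theorem splits_nodup_appellPoly_skeletonSeq_xi (d n : ℕ) :
    (appellPoly (skeletonSeq xiTaylorCoeff n) d).Splits ∧ (appellPoly (skeletonSeq xiTaylorCoeff n) d).roots.Nodup ∧
      (appellPoly (skeletonSeq xiTaylorCoeff n) d).natDegree = d :=
  splits_nodup_appellPoly_skeletonSeq xiTaylorCoeff n d (skelKappa_xi_pos n)

/-! ## ISOLATION: the test is one inequality family -/

/-- **ISOLATION (RH-FREE).** For `γ = xiTaylorCoeff`, `d ≥ 2` and any shift `n`, the skeleton sign test holds IFF the window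
Appell polynomial `P` and the skeleton `P⁰` have the same sign at every critical point of `P⁰`:
`SkeletonSignTest ξ d n ↔ ∀ e, (P⁰)′(e) = 0 → P(e)·P⁰(e) > 0`. All other certificate fields (degrees, leading signs,
`P⁰` hyperbolic with simple zeros) are discharged here. The right-hand side is the inequality the DATA engine measured
(`μ(d,n) > 0`, ET7) and the CAL certified on THEOREM α's region; it is NOT proved here for any cell. -/
theorem skeletonSignTest_xi_iff (d n : ℕ) (hd : 2 ≤ d) :
    SkeletonSignTest xiTaylorCoeff d n ↔
      ∀ e : ℝ, (derivative (appellPoly (skeletonSeq xiTaylorCoeff n) d)).eval e = 0 →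
        0 < (appellPoly (windowSeq xiTaylorCoeff n) d).eval e *
          (appellPoly (skeletonSeq xiTaylorCoeff n) d).eval e := by
  refine ⟨fun h => h.sameSign, fun h => ?_⟩
  have hpos : ∀ k, 0 < xiTaylorCoeff k := xiTaylorCoeff_pos_holds
  have hr0 : windowSeq xiTaylorCoeff n 0 = 1 := windowSeq_zero _ _ (hpos n).ne'
  have hs0 : skeletonSeq xiTaylorCoeff n 0 = 1 := skeletonSeq_zero _ _
  obtain ⟨hQs, hQnd, hQdeg⟩ := splits_nodup_appellPoly_skeletonSeq_xi d n
  exact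
    { natDegree_eq := by rw [natDegree_appellPoly _ d (by rw [hr0]; exact one_ne_zero), hQdeg]
      two_le := by rw [hQdeg]; exact hd
      leadingCoeff_pos := by
        rw [leadingCoeff_appellPoly _ d (by rw [hr0]; exact one_ne_zero),
          leadingCoeff_appellPoly _ d (by rw [hs0]; exact one_ne_zero), hr0, hs0, mul_one]
        exact one_pos
      splits := hQs
      nodup := hQnd
      sameSign := h }

/-! ## G1 for `ξ` and the label theorems -/

/-- **G1 for `ξ`**: the skeleton sign test at `(d, n)` implies `J^{d,n}_γ`, `γ = xiTaylorCoeff`, is hyperbolic. RH-FREE. -/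
theorem skeletonSignTest_xi_splits (d n : ℕ) (h : SkeletonSignTest xiTaylorCoeff d n) :
    (jensenPoly xiTaylorCoeff d n).Splits :=
  h.splits_jensenPoly xiTaylorCoeff_pos_holds

/-- **G1 verbatim** (HOME `JensenTargets` §2 `SkeletonSignTest_implies_splits`):
`∀ d n, 3 ≤ d → SkeletonSignTest ξ d n → (jensenPoly ξ d n).Splits`. RH-FREE. -/
theorem skeletonSignTest_implies_splits :
    ∀ d n : ℕ, 3 ≤ d → SkeletonSignTest xiTaylorCoeff d n → (jensenPoly xiTaylorCoeff d n).Splits :=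
  fun d n _ h => skeletonSignTest_xi_splits d n h

/-- **Label theorem (RH-FREE bookkeeping between typed targets, neither of which is proved):** the certificate form
P1⁺ `TheoremAlphaCert` implies the range form P1 `TheoremAlpha` (THEOREM α), cell by cell via G1. -/
theorem theoremAlpha_of_theoremAlphaCert (h : TheoremAlphaCert) : TheoremAlpha :=
  fun d n hd hn hdn => skeletonSignTest_xi_splits d n (h d n hd hn hdn)

/-- **Label theorem (RH-FREE bookkeeping):** THEOREM α (`n ≥ max(10⁴, 0.135 d³)`) implies the route's leaf statement
`JensenCubicRangeTwo` (`n ≥ 2d³`, all `d ≥ 3`): above the `10⁴` floor `2d³ ≤ n` gives `27 d³ ≤ 200 n`; below it `2d³ ≤ n < 10⁴`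
forces `d ≤ 17`, inside the tree's height-bought all-shift range `d ≤ 10⁶`
(`jensenPoly_xiTaylorCoeff_splits_allShifts_of_le_1e6'`, standard axioms). `TheoremAlpha` itself is NOT proved. -/
theorem jensenCubicRangeTwo_of_theoremAlpha (h : TheoremAlpha) : JensenCubicRangeTwo := by
  intro d n hd _ hdn
  by_cases hn : 10000 ≤ n
  · refine h d n hd hn ?_
    generalize d ^ 3 = D at hdn ⊢
    omega
  · have hd3 : d ≤ d ^ 3 := Nat.le_self_pow (by norm_num) d
    exact jensenPoly_xiTaylorCoeff_splits_allShifts_of_le_1e6' (by omega) n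

/-- **Label theorem (RH-FREE bookkeeping):** the Laguerre-skeleton assembly of the leaf — the CAL-certified certificate law
`TheoremAlphaCert` (NOT a tree theorem; its content is the isolated inequality family of `skeletonSignTest_xi_iff` on
`n ≥ max(10⁴, 0.135 d³)`) implies `JensenCubicRangeTwo`. -/
theorem jensenCubicRangeTwo_of_theoremAlphaCert (h : TheoremAlphaCert) : JensenCubicRangeTwo :=
  jensenCubicRangeTwo_of_theoremAlpha (theoremAlpha_of_theoremAlphaCert h)

/-- The flat tier: `TheoremAlphaCert` contains `TheoremAlphaCertFlat` (`3 ≤ d ≤ 41`, `n ≥ 10⁴`: then `27 d³ ≤ 27·41³ < 200·10⁴`).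
RH-FREE bookkeeping; neither side is proved. -/
theorem theoremAlphaCertFlat_of_theoremAlphaCert (h : TheoremAlphaCert) : TheoremAlphaCertFlat := by
  intro d n hd hd41 hn
  refine h d n hd hn ?_
  have h1 : d ^ 3 ≤ 41 ^ 3 := Nat.pow_le_pow_left hd41 3
  generalize d ^ 3 = D at h1 ⊢
  omega

end Summit.RiemannHypothesis.RiemannHypothesis.Theorems.JensenPolynomials

end
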